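import Summits.BirchSwinnertonDyer.Rank1Residual.GaloisImage.FiniteSingularComparisonOperatorPrimePow
import Summits.BirchSwinnertonDyer.Rank1Residual.GaloisImage.CanonicalKolyvaginDatumAdmissible
import HarnessLib

/-!
# The canonical finite–singular comparison map is an isomorphism, IX: ADMISSIBILITY of the
# canonical Kolyvagin datum at Sakamoto's primes over `ℚ` — PRIME-POWER modulus `ℤ/p^n`
# ([MR04] Lemma 1.2.3 = Rubin Ex. 1.9.7 for `R = ℤ/p^n`, e.g. `E[3^{k+1}]` in the N11 chain)
# (cell `b2b-bsdres`, team n1011, seat p11 gen 4, OWNERS row T-HCC-adm, sequel F2′; file 9)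

HONEST FRAMING (cell `b2b-bsdres`, run/shared/lean/b2b/bsd-rank1-residual/, verbatim in every
file): the goal of the cell is to DELETE the COMBINATION-SHAPED residual classes of the
Birch–Swinnerton-Dyer formula for ALL analytic-rank `≤ 1` elliptic curves over `ℚ` — "full BSD
formula for every rank `≤ 1` curve in class `C`" assembled STRICTLY from published theorems — so
that the rank-`≤ 1` remainder becomes exactly the CONSTRUCTION-SHAPED classes, which are TYPED
(missing-input `Prop`s), NOT attempted. This is not "finishing BSD". Team n1011 (N10 / N11, the
additive block X4 ∧ `p = 3`): research route on the CONSTRUCTION-SHAPED class X4; no claim beyond the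
stated classes; nothing is booked. TOOL theorems of Galois cohomology; no definition, no named fact,
no `sorry`.

## What is proved

The prime-power versions of files 3–4 (`FiniteSingularComparisonInjective`,
`CanonicalKolyvaginDatumAdmissible`): for a discrete `Γ_ℚ`-module `T` free of finite rank over
`ℤ/p^n` (`p` prime, `n ≥ 1`; e.g. `E[3^{k+1}]` with the instances of n1011-p13's
`SakamotoN11Instance`), `τ ∈ Gal(ℚ̄/ℚ(μ_{p^n}))` with `T/(τ − 1)T ≅ ℤ/p^n`, and a Kolyvagin datum
`D` with `D.primes = frobeniusClassPrimes ρ S τ (p^n)` and THE canonical comparison maps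
(`D.HasCanonicalComparison (p^n) η`):

* `FSComp.injective_fs_of_isFiniteSingularComparisonWith_primePow` (local) — `φ^{fs}` is injective
  on `H¹_ur` (file 8's `Q(φ⁻¹)`-injectivity + file 3's evaluation-at-Frobenius injectivity);
* **`FSComp.isAdmissible_of_hasCanonicalComparison_frobeniusClassPrimes_primePow : D.IsAdmissible`**
  ([MR04] Lemma 1.2.3 in full for `R = ℤ/p^n` over `ℚ`; surjectivity by counting with n1011-p18's
  (U)(T)(UT) at modulus `p^n`);
* `FSComp.exists_[eta_]kolyvaginDatum_isAdmissible_frobeniusClassPrimes_primePow` — n1011-p04's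
  existence with admissibility added.

References: B. Mazur, K. Rubin, Mem. AMS 799 (2004), Lemma 1.2.3 (pp. 10–11); K. Rubin, PCMI 18
(2011), Prop. 1.4.13, 1.9.5, Ex. 1.9.7; R. Sakamoto, JTNB 36 (2024) §2, §4.
-/

noncomputable section

open Field Polynomial Module NumberField IsDedekindDomain
open Literature.NumberTheory.GaloisRepresentations
open Literature.NumberTheory.GaloisRepresentations.DiscreteGaloisModule
open Literature.NumberTheory.GaloisCohomology
open scoped ContRepresentation Polynomial NumberField

namespace Summit.BirchSwinnertonDyer.Rank1Residual.GaloisImage.FSComp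

/-! ### §1 Local injectivity at prime-power modulus -/

section Local

universe u

variable {F : Type u} [Field F] [ValuativeRel F] [TopologicalSpace F] [IsNonarchimedeanLocalField F]
variable {M : Type u} [AddCommGroup M] [TopologicalSpace M] [DiscreteTopology M]
variable (ρ : DiscreteGaloisModule F M) (p n : ℕ) [Fact p.Prime] [NeZero n]
  [Module (ZMod (p ^ n)) M] [Module.Free (ZMod (p ^ n)) M] [Module.Finite (ZMod (p ^ n)) M]

/-- **`φ^{fs}` is injective on `H¹_ur(F, M)` — prime-power modulus** (`M` free over `ℤ/p^n`,
unramified, `M/(φ − 1)M ≃ ℤ/p^n`, any `fs` with `IsFiniteSingularComparisonWith ρ (p^n) fs φ τ`).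
[cite: MazurRubin2004, Lemma 1.2.3 (p. 10–11)] [cite: Rubin2011, Exercise 1.9.7 (p. 15)] -/
theorem injective_fs_of_isFiniteSingularComparisonWith_primePow (hI : ∀ τ ∈ absInertia F, ρ τ = 1)
    {φ τ : absoluteGaloisGroup F} (hφ : IsAbsArithFrob φ)
    (hcok : Nonempty (cokerSubOne ρ φ ≃+ ZMod (p ^ n)))
    {fs : galoisCohomology ρ 1 →+ ρ.SingularQuotient}
    (h : ρ.IsFiniteSingularComparisonWith (p ^ n) fs φ τ) :
    Function.Injective fun x : unramifiedSubgroup ρ 1 => fs (x : galoisCohomology ρ 1) := by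
  haveI : Finite M := Module.finite_of_finite (ZMod (p ^ n))
  have hI' : ∀ τ ∈ absInertia F, ∀ w : M, ρ τ w = w := fun τ hτ w => by
    rw [hI τ hτ, Module.End.one_apply]
  have hker : ∀ x : unramifiedSubgroup ρ 1, fs (x : galoisCohomology ρ 1) = 0 → x = 0 := by
    intro x hx
    obtain ⟨z, hz⟩ := oneCocycleClass_surjective ρ.toTopRep (x : galoisCohomology ρ 1)
    have hzur : oneCocycleClass ρ.toTopRep z ∈ unramifiedSubgroup ρ 1 := by rw [hz]; exact x.2
    have hz0 : ∀ τ ∈ absInertia F, z.1 τ = 0 :=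
      (X11b.LocBridge.mem_unramifiedSubgroup_one_iff_forall_eq_zero ρ hI' z).mp hzur
    have happ := h.apply_eq z 0 hzur (by rw [singularMap_oneCocycleClass_zero, hz, hx])
    have hQ : ρ.comparisonOp (p ^ n) φ (z.1 φ) = 0 := by rw [← happ]; rfl
    obtain ⟨m, hm⟩ := mem_range_of_comparisonOp_eq_zero_primePow ρ p n φ hcok (z.1 φ) hQ
    have hm' : z.1 φ = ρ φ m - m := by
      rw [← hm, AddMonoidHom.sub_apply, LinearMap.toAddMonoidHom_coe, AddMonoidHom.id_apply]
    have hcl := oneCocycleClass_eq_zero_of_apply_frob_eq ρ hI hφ z hz0 hm'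
    apply Subtype.ext
    rw [← hz, hcl]
    rfl
  intro x y hxy
  have hsub : fs ((x - y : unramifiedSubgroup ρ 1) : galoisCohomology ρ 1) = 0 := by
    rw [AddSubgroup.coe_sub, map_sub, sub_eq_zero]
    exact hxy
  exact sub_eq_zero.mp (hker _ hsub)

end Local

/-! ### §2 Admissibility at Sakamoto's primes over `ℚ`, prime-power modulus -/

section Rat

variable {M : Type} [AddCommGroup M] [TopologicalSpace M] [DiscreteTopology M]
variable (ρ : DiscreteGaloisModule ℚ M) (p n : ℕ) [Fact p.Prime] [NeZero n]
  [Module (ZMod (p ^ n)) M] [Module.Free (ZMod (p ^ n)) M] [Module.Finite (ZMod (p ^ n)) M]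

/-- **[MR04] Lemma 1.2.3 / Rubin Ex. 1.9.7 at prime-power modulus — the canonical Kolyvagin datum
on a free `ℤ/p^n`-module is ADMISSIBLE at Sakamoto's `τ`-class primes over `ℚ`**: for `T` free of
finite rank over `ℤ/p^n`, `τ ∈ Gal(ℚ̄/ℚ(μ_{p^n}))` with `T/(τ − 1)T ≅ ℤ/p^n`, `D` with
`D.primes = frobeniusClassPrimes ρ S τ (p^n)` and `D.HasCanonicalComparison (p^n) η`, every
`φ^{fs}_𝔮 : H¹_ur(ℚ_𝔮, T) → H¹(ℚ_𝔮, T)/H¹_ur` (`𝔮 ∈ 𝒫(τ)`) is a bijection.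
[cite: MazurRubin2004, Lemma 1.2.3 (p. 10–11)] [cite: Rubin2011, Exercise 1.9.7 (p. 15)]
[cite: Sakamoto2024, §4 (p. 925), the finite-singular comparison isomorphism] -/
theorem isAdmissible_of_hasCanonicalComparison_frobeniusClassPrimes_primePow
    (S : Set (HeightOneSpectrum (𝓞 ℚ))) {τ : absoluteGaloisGroup ℚ}
    (hτq : Nonempty (cokerSubOne ρ τ ≃+ ZMod (p ^ n))) (hτμ : τ ∈ rootsOfUnityFixer ℚ (p ^ n))
    {D : KolyvaginDatum ρ} (hP : D.primes = frobeniusClassPrimes ρ S τ (p ^ n))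
    {η : (q : HeightOneSpectrum (𝓞 ℚ)) → (ZMod (Ideal.absNorm q.asIdeal))ˣ}
    (hD : D.HasCanonicalComparison (p ^ n) η) : D.IsAdmissible := by
  classical
  have hp : p.Prime := Fact.out
  have hpn0 : p ^ n ≠ 0 := pow_ne_zero _ hp.ne_zero
  haveI : NeZero (p ^ n) := ⟨hpn0⟩
  haveI : Finite M := Module.finite_of_finite (ZMod (p ^ n))
  intro q hq
  have hq' : q ∈ frobeniusClassPrimes ρ S τ (p ^ n) := hP ▸ hq
  haveI : Fact (Ideal.absNorm q.asIdeal).Prime := ⟨prime_absNorm_rat q⟩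
  haveI : CharZero (q.adicCompletion ℚ) :=
    charZero_of_injective_algebraMap (algebraMap ℚ (q.adicCompletion ℚ)).injective
  haveI : NeZero ((Ideal.absNorm q.asIdeal : ℕ) : q.adicCompletion ℚ) :=
    ⟨Nat.cast_ne_zero.2 (Fact.out : (Ideal.absNorm q.asIdeal).Prime).ne_zero⟩
  have hI : ∀ t ∈ absInertia (q.adicCompletion ℚ), GaloisRep.toLocal q ρ t = 1 := fun t ht =>
    (GaloisRep.isUnramifiedAt_iff_toLocal_holds q ρ).1 hq'.2.2.1 t ht
  obtain ⟨φ, hφ⟩ := exists_isAbsArithFrob_holds (F := q.adicCompletion ℚ)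
  obtain ⟨g, hg⟩ := exists_toLocal_eq_conj ρ (p ^ n) S τ hq' hφ
  have hcok : Nonempty (cokerSubOne (GaloisRep.toLocal q ρ) φ ≃+ ZMod (p ^ n)) :=
    nonempty_cokerSubOne_equiv_of_eq_conj ρ (GaloisRep.toLocal q ρ) hg hτq
  obtain ⟨t, ht, hχt⟩ := modPCyclotomicCharacter_surjOn_absInertia_rat_holds q (η q)
  have hη : localNormCyclotomicCharacter q t = η q := by
    rw [localNormCyclotomicCharacter_eq_modPCyclotomicCharacterZMod]; exact hχt
  have hinj := injective_fs_of_isFiniteSingularComparisonWith_primePow (GaloisRep.toLocal q ρ) p n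
    hI hφ hcok (hD.at hq hφ ht hη)
  refine ⟨hinj, ?_⟩
  have hMN : ∀ m : M, (p ^ n) • m = 0 := fun m => by
    rw [← Nat.cast_smul_eq_nsmul (ZMod (p ^ n)), ZMod.natCast_self, zero_smul]
  have hM : ∀ m : M, (Ideal.absNorm q.asIdeal - 1) • m = 0 :=
    absNorm_sub_one_smul_eq_zero_of_mem_frobeniusClassPrimes ρ hq' hτμ hMN
  have hU : Nat.card (unramifiedSubgroup (GaloisRep.toLocal q ρ) 1) = p ^ n :=
    natCard_unramifiedSubgroup_toLocal_of_mem_frobeniusClassPrimes ρ hq' hτq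
  have hT : Nat.card (cyclotomicTransverse ρ (Sum.inr q)) = p ^ n :=
    natCard_cyclotomicTransverse_rat_of_mem_frobeniusClassPrimes' ρ hq' hτq hM
  have hUT := unramifiedSubgroup_sup_cyclotomicTransverse_eq_top_of_mem_frobeniusClassPrimes ρ hq'
    hM (modPCyclotomicCharacter_surjOn_absInertia_rat_holds q)
  set U := unramifiedSubgroup (GaloisRep.toLocal q ρ) 1 with hUdef
  haveI : Finite (cyclotomicTransverse ρ (Sum.inr q)) :=
    Nat.finite_of_card_ne_zero (by rw [hT]; exact hpn0)
  haveI : Finite U := Nat.finite_of_card_ne_zero (by rw [hU]; exact hpn0)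
  let π : cyclotomicTransverse ρ (Sum.inr q) → SingularQuotient (GaloisRep.toLocal q ρ) :=
    fun y => singularMap (GaloisRep.toLocal q ρ) y.1
  have hπ : Function.Surjective π := by
    intro c
    obtain ⟨x, rfl⟩ := QuotientAddGroup.mk_surjective c
    have hx : x ∈ U ⊔ cyclotomicTransverse ρ (Sum.inr q) := by rw [hUT]; exact AddSubgroup.mem_top x
    obtain ⟨u, hu, y, hy, rfl⟩ := AddSubgroup.mem_sup.mp hx
    refine ⟨⟨y, hy⟩, ?_⟩
    show singularMap (GaloisRep.toLocal q ρ) y = QuotientAddGroup.mk (u + y)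
    rw [QuotientAddGroup.mk_add, (QuotientAddGroup.eq_zero_iff u).mpr hu, zero_add]
    rfl
  haveI : Finite (SingularQuotient (GaloisRep.toLocal q ρ)) := Finite.of_surjective π hπ
  have hle : Nat.card (SingularQuotient (GaloisRep.toLocal q ρ)) ≤ p ^ n := by
    rw [← hT]; exact Nat.card_le_card_of_surjective π hπ
  have hge : p ^ n ≤ Nat.card (SingularQuotient (GaloisRep.toLocal q ρ)) := by
    rw [← hU]; exact Nat.card_le_card_of_injective _ hinj
  have hcard : Nat.card U = Nat.card (SingularQuotient (GaloisRep.toLocal q ρ)) := by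
    rw [hU]; exact le_antisymm hge hle
  exact ((Nat.bijective_iff_injective_and_card _).mpr ⟨hinj, hcard⟩).2

/-- **Existence with admissibility, prime-power modulus**: p04's
`exists_kolyvaginDatum_hasCanonicalComparison_frobeniusClassPrimes` at `N = p^n` with `D.IsAdmissible`
added. [cite: MazurRubin2004, Def. 1.2.2 and Lemma 1.2.3 (p. 10–11)] -/
theorem exists_kolyvaginDatum_isAdmissible_frobeniusClassPrimes_primePow
    (S : Set (HeightOneSpectrum (𝓞 ℚ))) {τ : absoluteGaloisGroup ℚ}
    (hτμ : τ ∈ rootsOfUnityFixer ℚ (p ^ n)) (hτq : Nonempty (cokerSubOne ρ τ ≃+ ZMod (p ^ n)))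
    (T : SelmerStructure ρ) (η : (q : HeightOneSpectrum (𝓞 ℚ)) → (ZMod (Ideal.absNorm q.asIdeal))ˣ)
    (hη : ∀ q ∈ frobeniusClassPrimes ρ S τ (p ^ n), Subgroup.zpowers (η q) = ⊤) :
    ∃ D : KolyvaginDatum ρ, D.primes = frobeniusClassPrimes ρ S τ (p ^ n) ∧ D.transverse = T ∧
      D.HasCanonicalComparison (p ^ n) η ∧ D.IsAdmissible := by
  haveI : NeZero (p ^ n) := ⟨pow_ne_zero _ (Fact.out : p.Prime).ne_zero⟩
  obtain ⟨D, hP, hT, hD⟩ :=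
    exists_kolyvaginDatum_hasCanonicalComparison_frobeniusClassPrimes ρ (p ^ n) S hτμ hτq T η hη
  exact ⟨D, hP, hT, hD,
    isAdmissible_of_hasCanonicalComparison_frobeniusClassPrimes_primePow ρ p n S hτq hτμ hP hD⟩

/-- **Primitive roots included, prime-power modulus** (`(ℤ/ℓ)ˣ` cyclic): `∃ η D`, canonical AND
admissible. [cite: MazurRubin2004, Lemma 1.2.3 (p. 10–11)] -/
theorem exists_eta_kolyvaginDatum_isAdmissible_frobeniusClassPrimes_primePow
    (S : Set (HeightOneSpectrum (𝓞 ℚ))) {τ : absoluteGaloisGroup ℚ}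
    (hτμ : τ ∈ rootsOfUnityFixer ℚ (p ^ n)) (hτq : Nonempty (cokerSubOne ρ τ ≃+ ZMod (p ^ n)))
    (T : SelmerStructure ρ) :
    ∃ (η : (q : HeightOneSpectrum (𝓞 ℚ)) → (ZMod (Ideal.absNorm q.asIdeal))ˣ) (D : KolyvaginDatum ρ),
      D.primes = frobeniusClassPrimes ρ S τ (p ^ n) ∧ D.transverse = T ∧
        D.HasCanonicalComparison (p ^ n) η ∧ D.IsAdmissible := by
  haveI : NeZero (p ^ n) := ⟨pow_ne_zero _ (Fact.out : p.Prime).ne_zero⟩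
  obtain ⟨η, D, hP, hT, hD⟩ :=
    exists_eta_kolyvaginDatum_hasCanonicalComparison_frobeniusClassPrimes ρ (p ^ n) S hτμ hτq T
  exact ⟨η, D, hP, hT, hD,
    isAdmissible_of_hasCanonicalComparison_frobeniusClassPrimes_primePow ρ p n S hτq hτμ hP hD⟩

end Rat

end Summit.BirchSwinnertonDyer.Rank1Residual.GaloisImage.FSComp

end
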